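import Literature.NumberTheory.EllipticCurves.Kato2004.LocPKummerLog
import Literature.NumberTheory.EllipticCurves.MordellWeil
import Literature.NumberTheory.EllipticCurves.Sha
import HarnessLib

/-!
# Kato 2004 (Astérisque 295) §14.1 and §14.9 (14.9.3) READ IN THE RANK-ONE `Ш[p^∞]`-FINITE CASE:
# the localisation `loc_p : H¹(ℤ[1/p], T_pW) → H¹(ℚ_p, T_pW)` has TORSION KERNEL — ONE named fact on
# PINNED objects (the tree's `integralH1` at the bottom layer, s2-c3's finite-level localisation
# `Kato2004.locModPk`), the reading (3.1″) of the Kato–zeta / Perrin-Riou road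

Topic `NumberTheory/EllipticCurves`, sub-directory `Kato2004` (namespace = path).  Cell `bsd-cn100`,
prover seat `bsd-cn100-s2b-c3` (g6).  Companion of `Kato2004/IwasawaH2DescentRankOne.lean` (bsd-cn100-ty
g7, the reading (3.1′) `finite_descentCokernel_of_rankOne`): the SECOND print reading of
Burungale–Skinner's §10.1.3 that the registered lines `kato-zeta-perrin-riou` of crux B of routes
`CongruentShaFreeCut` (stmt-BirchSwinnertonDyer-19080, `(E_n, 2)`) and `MordellShaFreeCut`
(stmt-BirchSwinnertonDyer-19160, `(W, 3)`, `j(W) = 0`) consume as the stub `stub_reading31b` («in rank one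
with `Ш[p^∞]` finite, a pinned class that is not `ℤ_p`-torsion has NON-ZERO Kummer logarithm»).  The
Summits-side theorem `reading31b_of_fact` (seat s2b-c3, `Theorems/CongruentShaFreeCutKatoReading31b.lean`)
derives that stub, for every `W` and `p`, from THIS fact and tree theorems only (the kernel of the
`p`-adic logarithm on `E(ℚ_p)` is the torsion — `Additive.LocalLog.padicLog_eq_zero_iff`, AEC IV.6.4 /
VII.6.3 — and the additivity of the local Kummer map).  HONEST FRAMING: one named fact (D-0014;
review-queued; net debt +1), nothing else; BSD is not advanced; the fact is a cited reading of Kato's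
general statements, weaker than print in scope (only `T_pW`, `K = ℚ`, the rank-one case), never stronger.
No `instance`, no notation.

## The statement and its sources (K. Kato, Astérisque 295 (2004); `[p. N]` = printed page; store key
`paper:doi-10-24033-ast-639`)

FACT `locP_kernel_isTorsion_of_rankOne`: for every elliptic curve `W/ℚ`, every prime `p`, every
`ℤ_p`-extension datum `κ` of `ℚ` (only its bottom layer `κ.layerSubgroup 0 = Γ_ℚ` is used) and every
INTEGRAL class `x ∈ H¹(ℤ[1/p], T_pW)` (the tree's `integralH1 (tateRep W p) p (κ.layerSubgroup 0)`, Kato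
§8.2 / Lemma 8.5): if `rank_ℤ W(ℚ) = 1`, `Ш(W)[p^∞]` is finite, and the localisation of `x` at `p`
vanishes at EVERY finite level (`∀ k, locModPk W p k (layerZeroToTop W p κ x) = 0`, i.e. `loc_p x = 0` in
`H¹(ℚ_p, T_pW) = lim←_k H¹(ℚ_p, W[p^k])`), then `x` is `ℤ_p`-torsion: `p^j · x = 0` for some `j`.
READING (every step a general printed statement of Kato for `T = T_pW`, `K = ℚ`, or elementary; none
uses CM or the reduction type):
* (R1) **§14.9 (14.9.3) [p. 240]** (for "`K` a finite extension of `ℚ` … `T` a finitely generated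
  `O_L`-module endowed with a continuous `O_L`-linear action of `Gal(K̄/K)` unramified at almost all
  finite places" with `V` de Rham at `v ∣ p` — true for `T_pE`): the sequence
  "`0 → H¹(O_K[1/p], T)/H¹_f → H¹(K ⊗ ℚ_p, T)/H¹_f → S(K, T*(1) ⊗ ℚ/ℤ)^∨ → …`" is "exact in the case
  `p ≠ 2`, and exact up to `×2` in the case `p = 2`": a class of `H¹(ℤ[1/p], T_pE)` whose localisation at
  `p` lies in `H¹_f(ℚ_p, T_pE)` — in particular one with `loc_p x = 0` — lies in
  `H¹_f(ℤ[1/p], T_pE) = S(ℚ, T_pE)` (up to `2`-torsion when `p = 2`, harmless for a torsion conclusion).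
* (R2) **§14.1 [p. 235]**: "If `A` is an abelian variety over `K`, the usual Selmer group `Sel(K, A)` of
  `A` coincides with `Sel(K, T_p(A))`" — so `S(ℚ, T_pE)` is the compact `p^∞`-Selmer group
  `lim←_k Sel_{p^k}(E/ℚ)`, an extension of `Hom(ℚ_p/ℤ_p, Ш(E)[p^∞])`-type terms by `E(ℚ) ⊗ ℤ_p` modulo
  finite groups; with `Ш(E)[p^∞]` FINITE it is `E(ℚ) ⊗ ℤ_p` up to finite kernel and cokernel
  (`E(ℚ)[p^∞]` and `0`).
* (R3) elementary (= step (R5) of `IwasawaH2DescentRankOne.lean`): if `rank_ℤ E(ℚ) = 1` then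
  `E(ℚ) ⊗ ℤ_p ≅ ℤ_p ⊕ (finite)` is generated up to finite index by the Kummer class `κ(P)` of a
  non-torsion `P ∈ E(ℚ)`, and `loc_p κ(P) = κ_p(P) ≠ 0` is NOT torsion in `H¹(ℚ_p, T_pE)` (a
  non-torsion rational point is non-torsion in `E(ℚ_p) ≅ ℤ_p × (finite)` and the local Kummer map
  `E(ℚ_p) ⊗ ℤ_p ↪ H¹(ℚ_p, T_pE)` is injective).
Chain: `loc_p x = 0` ⟹(R1) `x ∈ S(ℚ, T_pE)` (up to `×2`) ⟹(R2)+(R3) `x = a·κ(P) + (torsion)` with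
`a ∈ ℤ_p`, and `0 = loc_p x = a·κ_p(P) + (torsion)` forces `a = 0` ⟹ `x` is torsion.  PRINTED INSTANCE
of the conclusion: Burungale–Skinner, App. A §10.1.3 [p. 34]: "So it follows … that `0 ≠ z_E ∈ H¹(ℚ, V)`.
Since `Sel_st(E)` is finite, it further follows that `0 ≠ loc_p(z_E) ∈ H¹(ℚ_p, V)`" — for `E` CM and `p`
supersingular (their standing hypotheses; the deduction uses neither).  Referee flag
`Kato-14.9.3-locp-kernel-rank-one-reading` (non-verbatim: the identification of the tree's finite-level
`locModPk` family with `loc_p` into `H¹(ℚ_p, T_pE) = lim← H¹(ℚ_p, E[p^k])` — `E[p^k](ℚ_p)` finite, so the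
Mittag-Leffler condition holds; step (R3)).

WHY ON PINNED OBJECTS.  The statement mentions only the tree's `tateRep`/`H1`/`integralH1` (bsd-smallim,
`Kato2004/IwasawaCohomology*`), `layerZeroToTop` and `locModPk` (seat s2-c3, `Kato2004/LocPKummerLog.lean`,
the localisation modulo `p^k` into the codomain of the tree's `localKummerMap`), `mordellWeilRank` and
`sha`; no abstract module occurs.  It is exactly what the road's `h31b` needs and nothing more:
`reading31b_of_fact` (Summits side) feeds it the pinned Kato class `J.toH1 (eA (D.ι [z]))` multiplied by
the torsion order of the Kummer witness point.

## References

* K. Kato, *p-adic Hodge theory and values of zeta functions of modular forms*, Astérisque 295 (2004):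
  §8.2 and Lemma 8.5 (pp. 180–184), §14.1 (p. 235), §14.9 (14.9.1)–(14.9.3) and the local duality
  (pp. 239–240) — store text `paper:doi-10-24033-ast-639`. [Kato2004Asterisque]
* A. A. Burungale, C. Skinner, App. A to Alpöge–Bhargava–Shnidman, arXiv:2210.10730: Thm. 10.1,
  §10.1.2–§10.1.3 (pp. 33–34) — store text `paper:arxiv-2210.10730`. [AlpogeBhargavaShnidman2022]
* S. Bloch, K. Kato, *L-functions and Tamagawa numbers of motives* (1990), Def. 3.10 / Ex. 3.11 (the
  Kummer image `H¹_f(ℚ_p, V)` of an abelian variety). [BlochKato1990]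
* Tree: `Kato2004/LocPKummerLog.lean` (`locModPk`, `layerZeroToTop`), `Kato2004/IwasawaCohomologyLevelZero.lean`
  (`integralH1` at level `0`), `Kato2004/IwasawaH2DescentRankOne.lean` (the companion reading (3.1′)).
-/

noncomputable section

open Field
open Literature.NumberTheory.GaloisRepresentations
open Literature.NumberTheory.EllipticCurves Literature.NumberTheory.EllipticCurves.Kato2004
open Literature.NumberTheory.EllipticCurves.Kato2004.EulerSystemValues

namespace Literature.NumberTheory.EllipticCurves.Kato2004

/-- **Kato 2004, §14.9 (14.9.3) (p. 240) with §14.1 (p. 235), READ in the rank-one `Ш[p^∞]`-finite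
case (module docstring (R1)–(R3); printed instance of the conclusion: Burungale–Skinner App. A §10.1.3,
«Since `Sel_st(E)` is finite, it further follows that `0 ≠ loc_p(z_E)`», for `E` CM and `p`
supersingular): the localisation `loc_p : H¹(ℤ[1/p], T_pW) → H¹(ℚ_p, T_pW)` has TORSION KERNEL.**  For
every elliptic curve `W/ℚ`, every prime `p`, every `ℤ_p`-extension datum `κ` of `ℚ` and every integral
class `x ∈ H¹(ℤ[1/p], T_pW)` (`integralH1` at the bottom layer `κ.layerSubgroup 0 = Γ_ℚ`): if
`rank_ℤ W(ℚ) = 1` (`W.mordellWeilRank = 1`), `Ш(W)[p^∞]` is finite, and the localisation of `x` at `p`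
vanishes modulo every `p^k` (`locModPk`, through `layerZeroToTop`), then `p^j · x = 0` for some `j`.
By (14.9.3) such an `x` lies in `H¹_f(ℤ[1/p], T_pW) = S(ℚ, T_pW)` (exact up to `×2` at `p = 2`), which by
§14.1 is the compact Selmer group, `= ℤ_p·κ(P) ⊕ (finite)` in rank one with `Ш[p^∞]` finite, and
`loc_p κ(P) ≠ 0` is non-torsion.  A statement on PINNED objects only; its consumer is the Summits-side
`reading31b_of_fact` (= the road's binder `h31b` for every descent datum).  Weaker than print in scope
(only `T_pW`, `K = ℚ`, the rank-one case), never stronger.  Named fact; nothing asserted; no `_holds`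
expected soon (size L: Poitou–Tate for `T_pE` over `ℚ`, the compact-Selmer identification, the
inverse-limit description of `H¹(ℚ_p, T_pE)`).  Referee flag `Kato-14.9.3-locp-kernel-rank-one-reading`.
[cite: Kato2004Asterisque, §14.9 (14.9.3) (p. 240), §14.1 (p. 235), §8.2 and Lemma 8.5 (pp. 180–184)]
[cite: AlpogeBhargavaShnidman2022, App. A §10.1.3 (p. 34) with Thm. 10.1 (printed instance: CM, supersingular p)] -/
def locP_kernel_isTorsion_of_rankOne : Prop :=
  ∀ (W : WeierstrassCurve ℚ) [W.IsElliptic] (p : ℕ) [Fact p.Prime]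
    [ContinuousSMul ℤ_[p] (W.tateModule p)] (κ : ZpExtension ℚ p)
    (x : H1 (tateRep W p) (κ.layerSubgroup 0)),
    x ∈ integralH1 (tateRep W p) p (κ.layerSubgroup 0) →
      W.mordellWeilRank = 1 → Finite (AddCommGroup.primaryComponent W.sha p) →
        (∀ k : ℕ, locModPk W p k (layerZeroToTop W p κ x) = 0) →
          ∃ j : ℕ, ((p : ℤ_[p]) ^ j) • x = 0

end Literature.NumberTheory.EllipticCurves.Kato2004

end
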